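import Summits.Ventures.CertifiedArithmetic.Expansions.WeakExpansionScaleLevels

/-!
# Weakly nonoverlapping expansions, part 8 (§12.3–12.4): Theorem 3, closure under SCALE-EXPANSION

HONEST FRAMING (ENGINES group, unit `eng-quad-4`, kernels lane of the `certquad` engine — shared
numerical engines serving client cells; rigour lives in the verifiers; every published number
belongs to a client cell's ledger, not to the engines group): NEW WORK of the lane's Lean line, not a
published result, hence under `Summits/Ventures/` with no citation tag; nothing here is cited anywhere
as a literature fact.  Parts 1–6 (`WeakExpansion*.lean`: the class W = `IsWeakExpansion`, Theorems 1–2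
on FAST-EXPANSION-SUM) and part 7 (`WeakExpansionScaleLevels.lean`: levels, Lemma 20 for weak pairs)
precede.  This file introduces no definitions.

THEOREM 3 (`scaleExpansion_isWeakExpansion`, `…_roundTiesEven`, `…_twoProdFMA_…`).  For any precision
`p ≥ 1`, any round-to-nearest rounding whose roundoff is 2-below its result (`RoundoffBelow 2`, e.g.
IEEE round-half-even), an exact two-product on the operands and the no-underflow model of
`Literature/ComputerArithmetic/Shewchuk1997/ScaleExpansion.lean` (§Lemma 20: `b = M_b·2^kb`,
components in `F_p ∩ 2^(emin−kb)·F`): if `e` is weakly nonoverlapping then so is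
`h = SCALE-EXPANSION(e, b)`, with `Σ hᵢ = b·Σ eᵢ` and `2m` float components.  Shewchuk's Theorem 19
gives this for the classes "nonoverlapping" (any tie rule) and "nonadjacent" (round-to-even); his
Corollary 22 claimed it for "strongly nonoverlapping", which is false (`ScaleExpansionCounterexample.lean`:
`⟨5, 16, −32⟩·13 = ⟨1, 0, 16, 0, 0, −160⟩`, `p = 4`).  With Theorem 2 the class W — containing every
nonadjacent and every strongly nonoverlapping expansion, contained in the nonoverlapping ones — is
closed under BOTH workhorse operations of the adaptive predicates under IEEE default rounding, which
is what their error analysis uses ("the input is strongly nonoverlapping because it was produced by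
SCALE-EXPANSION or FAST-EXPANSION-SUM").

PROOF (§12.3–12.4).  Write the loop step on `eᵢ = x` (remaining components `xs`, accumulator `Q`) as
`Tᵢ + tᵢ = x·b`, `(Q', h₁) = TWO-SUM(Q, tᵢ)`, `(Q'', h₂) = FAST-TWO-SUM(Tᵢ, Q')`.  (a) `tᵢ` is
2-below every later product `y·b` (part 7: Lemma 20 with `c = 2` if `x` is 2-below `y`; `tᵢ = 0` if
`x` is a one-bit number).  Hence `h₁` (`|h₁| ≤ |tᵢ|`; 2-below `Q'` and `Tᵢ` by `RoundoffBelow 2`) is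
2-below everything later, by the common grid.  (b) `h₂` is 2-below `Q''` (FAST-TWO-SUM,
`RoundoffBelow 2`) and, by Lemma 21, 2-below `y·b` whenever `x` is 2-below `y`.  If some later `y₀` is
merely weakly above `x` then `|x| = 2^a`, every later `y` is a multiple of `2^(a+1)`, and Lemma 21 with
`r = a + 1` gives `|h₂| ≤ 2^(a+kb)`: so `h₂` is 2-below every `y·b` unless `|h₂| = 2^(a+kb)` EXACTLY,
when it is a one-bit number 1-below everything later — a CRITICAL output, recording that `e` has an
adjacency at level `a`.  (c) So (`scaleExpansionLoop_pairwise_levels`) every output is 2-below every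
later output or critical of some level of `e`; two adjacent critical outputs `±2^(a+kb)`,
`±2^(a'+kb)` force `a' = a + 1`, two consecutive adjacency levels in `e` — impossible for weakly
nonoverlapping `e` (part 7); `isWeakExpansion_of_pairwise_levels` concludes.

EVIDENCE BEFORE PROOF (exact rational model of `p`-bit arithmetic, brute force; unit work folder):
round-half-even, `p = 4`, all weakly nonoverlapping `e` with ≤ 3 nonzero components (gaps ≤ 4 bits)
times all odd `b < 2^p`: 565 632 runs, 0 failures of the conclusion (sum, nonoverlapping, class W);
`p = 3`: 57 696 runs, `p = 2`: 4 024 runs, 0 failures; sampled: `p = 4` and `p = 5` with ≤ 6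
components and gaps ≤ 6 bits, 120 000 + 60 000 runs, `p = 6` with ≤ 4 components, 3 000 runs,
0 failures.  The tie rule is load-bearing: with round-half-AWAY
`SCALE-EXPANSION(⟨3, −8⟩, 7) = ⟨−1, 0, 2, −36⟩` (`p = 4`: `−1 | 2 | −36 = −9·2^2` is a double
adjacency), with round-half-to-zero `⟨3, −8⟩·9 = ⟨1, 0, −2, −44⟩`, with round-half-to-odd
`⟨3, 24⟩·9 = ⟨1, −2, 4, 240⟩` — outputs nonoverlapping (Theorem 19) but not weakly nonoverlapping.
-/

namespace Summit.Ventures.CertifiedArithmetic.Expansions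

open Literature.ComputerArithmetic.JeannerodRump2018
open Literature.ComputerArithmetic.BoldoJeannerodMelquiondMuller2023 hiding twoSum twoSum_fst isFloat_twoSum
open Literature.ComputerArithmetic.JoldesMullerPopescu2017 (abs_fl_le_of_abs_le)
open Literature.ComputerArithmetic.Shewchuk1997

variable {p : ℕ} {emin : ℤ} {fl : ℚ → ℚ}

/-! ### §12.3  The loop: every output is 2-below everything later, or critical -/

/-- **THE LOOP (Lines 2–6) on weak input, round-to-even.**  From a sound state (the hypotheses of
`scaleExpansionLoop_spec`) with the remaining components pairwise weakly below: every output `u` is,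
against every later output `v`, EITHER 2-below `v`, OR 1-below `v` and a one-bit number
`|u| = 2^(a+kb)` for a level `a` at which the remaining input has an adjacency (a component `±2^a`
followed by one it is adjacent to). -/
theorem scaleExpansionLoop_pairwise_levels (hp : 1 ≤ p) (hfl : IsRoundNearest p emin fl)
    (hfl2 : RoundoffBelow 2 fl) {tp : ℚ → ℚ → ℚ × ℚ} {b : ℚ} {Mb kb : ℤ}
    (hbrep : b = (Mb : ℚ) * 2 ^ kb) (hMb : |Mb| < 2 ^ p) :
    ∀ (es : List ℚ) (Q : ℚ), (∀ x ∈ es, IsFloat p emin x) → (∀ x ∈ es, IsFloat p (emin - kb) x) →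
      es.Pairwise WeakBelow →
      (∀ x ∈ es, (tp x b).1 = fl (x * b) ∧ (tp x b).1 + (tp x b).2 = x * b) →
      IsFloat p emin Q →
      (∀ y ∈ es, ∃ R : ℤ, emin ≤ R + kb ∧ OnGrid R y ∧ |Q| ≤ (2 : ℚ) ^ R * |b|) →
      (scaleExpansionLoop tp fl b es Q).Pairwise fun u v => Below 2 u v ∨
        (Below 1 u v ∧ ∃ a : ℤ, |u| = (2 : ℚ) ^ (a + kb) ∧
          ¬ es.Pairwise fun x y => |x| = (2 : ℚ) ^ a → Below 2 x y) := by
  have h2 : (2 : ℚ) ≠ 0 := by norm_num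
  intro es
  induction es with
  | nil =>
    intro Q _ _ _ _ _ _
    rw [scaleExpansionLoop_nil]; exact List.pairwise_singleton _ _
  | cons x xs ih =>
    intro Q hF hU hW htp hQ hinv
    obtain ⟨-, hxsF⟩ := List.forall_mem_cons.mp hF
    obtain ⟨hxU, hxsU⟩ := List.forall_mem_cons.mp hU
    obtain ⟨hx1, hxs⟩ := List.pairwise_cons.mp hW
    obtain ⟨⟨hT, hTt⟩, htps⟩ := List.forall_mem_cons.mp htp
    rw [scaleExpansionLoop_cons]
    set T := (tp x b).1 with hTdef
    set t := (tp x b).2 with htdef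
    have ht : t = x * b - fl (x * b) := by linarith
    have hTF : IsFloat p emin T := by rw [hT]; exact (hfl _).1
    have htF : IsFloat p emin t := by
      obtain ⟨Mx, kx, hMx, hkx, hx⟩ := hxU
      have := (isFloat_fl_mul_sub hp hfl hMx hMb (by omega : emin ≤ kx + kb)).neg
      rw [neg_sub, ← hx, ← hbrep, ← ht] at this; exact this
    set Q₁ := (twoSum fl Q t).1 with hQ₁def
    have hQ₁ : Q₁ = fl (Q + t) := rfl
    set h₁ := (twoSum fl Q t).2 with hh₁def
    have hh₁ : h₁ = Q + t - fl (Q + t) := (twoSum_exact hp hfl hQ htF).1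
    set Q₂ := (fastTwoSum fl T Q₁).1 with hQ₂def
    have hQ₂ : Q₂ = fl (T + Q₁) := rfl
    set h₂ := (fastTwoSum fl T Q₁).2 with hh₂def
    have hQ₁F : IsFloat p emin Q₁ := (isFloat_twoSum hfl Q t).1
    have hQ₂F : IsFloat p emin Q₂ := (isFloat_fastTwoSum hfl T Q₁).1
    have hrestF : ∀ {Q' : ℚ}, IsFloat p emin Q' →
        ∀ z ∈ scaleExpansionLoop tp fl b xs Q', IsFloat p emin z :=
      fun hQ' => isFloat_of_mem_scaleExpansionLoop hfl hQ'
    by_cases hxb : x * b = 0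
    · -- a zero component (or `b = 0`): outputs `0, 0`, accumulator unchanged
      have hT0 : T = 0 := by rw [hT, hxb, fl_zero hfl]
      have ht0 : t = 0 := by rw [ht, hxb, fl_zero hfl, sub_zero]
      have hQ₁Q : Q₁ = Q := by rw [hQ₁, ht0, add_zero, fl_eq_self hfl hQ]
      have hh₁0 : h₁ = 0 := by rw [hh₁, ht0, add_zero, fl_eq_self hfl hQ, sub_self]
      have hFTS : fastTwoSum fl T Q₁ = (Q, 0) := by
        rw [hT0, hQ₁Q]; exact fastTwoSum_zero_left hfl hQ
      have hQ₂Q : Q₂ = Q := by rw [hQ₂def, hFTS]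
      have hh₂0 : h₂ = 0 := by rw [hh₂def, hFTS]
      rw [hQ₂Q, hh₁0, hh₂0, List.pairwise_cons, List.pairwise_cons]
      refine ⟨fun z hz => Or.inl ?_, fun z hz => Or.inl (below_zero_left (hrestF hQ z hz) 2),
        pairwise_levels_mono x (ih Q hxsF hxsU hxs htps hQ fun y hy =>
          hinv y (List.mem_cons_of_mem x hy))⟩
      rcases List.mem_cons.mp hz with rfl | hz
      · exact below_zero_right 2 0
      · exact below_zero_left (hrestF hQ z hz) 2
    -- the main case: `x ≠ 0`, `b ≠ 0`
    have hx0 : x ≠ 0 := fun h => hxb (by rw [h, zero_mul])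
    obtain ⟨R, hR, hxR, hQR⟩ := hinv x List.mem_cons_self
    have hfts : |Q₁| ≤ |T| := abs_fl_add_le_abs_fst hp hfl hbrep hMb hQ hR hxR hQR hxb hT hTt
    have hh₂ : h₂ = T + Q₁ - fl (T + Q₁) := (fastTwoSum_exact hp hfl hTF hQ₁F hfts).2.2.1
    -- every later `y` lies on a grid `2^s` with `|x| < 2^s` (weakly below ⇒ nonoverlapping)
    have hgap : ∀ y ∈ xs, ∃ s : ℤ, emin - kb ≤ s ∧ OnGrid s y ∧ |x| < (2 : ℚ) ^ s := by
      intro y hy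
      obtain ⟨s, hs, hyG, hcs⟩ := (hx1 y hy).below_one.normalize (hxsU y hy)
      exact ⟨s, hs, hyG, by simpa using hcs⟩
    have hprodG : ∀ {y : ℚ} {s : ℤ}, OnGrid s y → OnGrid (s + kb) (y * b) := by
      rintro y s ⟨ρ, hy⟩
      exact ⟨ρ * Mb, by rw [hy, hbrep, zpow_add₀ h2]; push_cast; ring⟩
    -- Lemma 21 re-establishes the invariant for `Q₂ᵢ`; the induction hypothesis
    have hinv' : ∀ y ∈ xs, ∃ R' : ℤ, emin ≤ R' + kb ∧ OnGrid R' y ∧ |Q₂| ≤ (2 : ℚ) ^ R' * |b| := by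
      intro y hy
      obtain ⟨s, hs, hyG, hxs'⟩ := hgap y hy
      exact ⟨s, by omega, hyG,
        (lemma21_step hp hfl hbrep hMb hQ htF hR hxR hQR hx0 hxs' hT hTt).1⟩
    have hrest := pairwise_levels_mono x (ih Q₂ hxsF hxsU hxs htps hQ₂F hinv')
    rw [List.pairwise_cons, List.pairwise_cons]
    refine ⟨?_, ?_, hrest⟩
    · -- `h₁`: 2-below `Q₁`, `Tᵢ` (|h₁| ≤ |tᵢ|) and every later product — never critical
      have hB1 : Below 2 h₁ Q₁ := twoSum_below hp hfl hfl2 hQ htF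
      have hh₁le : |h₁| ≤ |t| := by
        rw [hh₁, abs_sub_comm]; exact (abs_err_add_le hfl hQ htF).2
      have htT : Below 2 t T := by rw [ht, hT]; exact hfl2 (x * b)
      obtain ⟨g, hg, hcg, hQ₁g, hLg, htpG⟩ := exists_grid_of_below hp hfl hbrep hMb hxsU htps
        hQ₁F hB1 (L := [T]) (by simpa using hTF)
        (by simpa using htT.mono_left (by norm_num) hh₁le)
        fun y hy => (below_two_err_mul_of_weakBelow hp hfl hbrep hMb hxU (hxsU y hy) (hx1 y hy)
          hT hTt).mono_left (by norm_num) hh₁le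
      have hTg : OnGrid g T := hLg T (by simp)
      have hQ₂g : OnGrid g Q₂ := (hTg.add hQ₁g).fl_of hp hfl hg
      have hh₂g : OnGrid g h₂ := by rw [hh₂]; exact (hTg.add hQ₁g).sub hQ₂g
      have hrestg := onGrid_of_mem_scaleExpansionLoop hp hfl hg hQ₂g htpG
      intro z hz
      refine Or.inl ?_
      rcases List.mem_cons.mp hz with rfl | hz
      · exact ⟨g, hh₂g, hcg⟩
      · exact ⟨g, hrestg z hz, hcg⟩
    · -- `h₂`: 2-below `Q₂` always; against the later products, Lemma 21
      have hB1 : Below 2 h₂ Q₂ := fastTwoSum_below hp hfl hfl2 hTF hQ₁F hfts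
      have closure : ∀ {c : ℚ}, Below c h₂ Q₂ → (∀ y ∈ xs, Below c h₂ (y * b)) →
          ∀ z ∈ scaleExpansionLoop tp fl b xs Q₂, Below c h₂ z := by
        intro c hcQ hys z hz
        obtain ⟨g, hg, hcg, hQ₂g, -, htpG⟩ := exists_grid_of_below hp hfl hbrep hMb hxsU htps
          hQ₂F hcQ (L := []) (by simp) (by simp) hys
        exact ⟨g, onGrid_of_mem_scaleExpansionLoop hp hfl hg hQ₂g htpG z hz, hcg⟩
      have hP2 : ∀ y ∈ xs, Below 2 x y → Below 2 h₂ (y * b) := by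
        intro y hy hb2
        obtain ⟨s, hs, hyG, hcs⟩ := hb2.normalize (hxsU y hy)
        obtain ⟨r, hxr, -, hcr⟩ := exists_exp_of_gap (Or.inr rfl) hxU hx0 hs hcs
        have hcore := (lemma21_step hp hfl hbrep hMb hQ htF hR hxR hQR hx0 hxr hT hTt).2
        refine ⟨s + kb, hprodG hyG, ?_⟩
        calc 2 * |h₂| ≤ 2 * (2 : ℚ) ^ (r + kb - 1) := by
              rw [hh₂]; exact mul_le_mul_of_nonneg_left hcore (by norm_num)
          _ < (2 : ℚ) ^ (s + kb) := hcr
      by_cases hall : ∀ y ∈ xs, Below 2 x y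
      · exact fun z hz => Or.inl (closure hB1 (fun y hy => hP2 y hy (hall y hy)) z hz)
      push Not at hall
      obtain ⟨y₀, hy₀, hxy₀⟩ := hall
      obtain ⟨a, hxa⟩ : ∃ a : ℤ, |x| = (2 : ℚ) ^ a := by
        rcases hx1 y₀ hy₀ with hb2 | ⟨-, ha⟩
        · exact absurd hb2 hxy₀
        · exact ha
      have hlev : ¬ (x :: xs).Pairwise fun x y => |x| = (2 : ℚ) ^ a → Below 2 x y :=
        fun hpw => hxy₀ ((List.pairwise_cons.mp hpw).1 y₀ hy₀ hxa)
      -- Lemma 21 with `r = a + 1`: `|h₂| ≤ 2^(a+kb)`; later components are multiples of `2^(a+1)`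
      have hxr : |x| < (2 : ℚ) ^ (a + 1) := by
        rw [hxa]; exact zpow_lt_zpow_right₀ (by norm_num) (by omega)
      have hh₂le : |h₂| ≤ (2 : ℚ) ^ (a + kb) := by
        have hcore := (lemma21_step hp hfl hbrep hMb hQ htF hR hxR hQR hx0 hxr hT hTt).2
        rw [show a + 1 + kb - 1 = a + kb by ring] at hcore
        rwa [hh₂]
      have hys : ∀ y ∈ xs, ∃ s : ℤ, a + 1 ≤ s ∧ OnGrid (s + kb) (y * b) := by
        intro y hy
        obtain ⟨s, -, hyG, hxs⟩ := hgap y hy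
        rw [hxa] at hxs
        exact ⟨s, (zpow_lt_zpow_iff_right₀ (by norm_num : (1 : ℚ) < 2)).mp hxs, hprodG hyG⟩
      by_cases hcrit : |h₂| = (2 : ℚ) ^ (a + kb)
      · -- the CRITICAL output: a one-bit number, 1-below everything later, level `a` recorded
        have hb1 : ∀ y ∈ xs, Below 1 h₂ (y * b) := by
          intro y hy
          obtain ⟨s, hs, hyG⟩ := hys y hy
          refine ⟨s + kb, hyG, ?_⟩
          rw [one_mul, hcrit]; exact zpow_lt_zpow_right₀ (by norm_num) (by omega)
        exact fun z hz => Or.inr ⟨closure (hB1.anti (by norm_num)) hb1 z hz, a, hcrit, hlev⟩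
      · have hlt : |h₂| < (2 : ℚ) ^ (a + kb) := lt_of_le_of_ne hh₂le hcrit
        have hb2 : ∀ y ∈ xs, Below 2 h₂ (y * b) := by
          intro y hy
          obtain ⟨s, hs, hyG⟩ := hys y hy
          refine ⟨s + kb, hyG, ?_⟩
          calc 2 * |h₂| < 2 * (2 : ℚ) ^ (a + kb) := by linarith
            _ = (2 : ℚ) ^ (a + kb + 1) := by rw [zpow_add_one₀ h2]; ring
            _ ≤ (2 : ℚ) ^ (s + kb) := zpow_le_zpow_right₀ (by norm_num) (by omega)
        exact fun z hz => Or.inl (closure hB1 hb2 z hz)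

/-! ### §12.4  Theorem 3 -/

/-- **THEOREM 3 (closure of the class W under SCALE-EXPANSION).**  For any precision `p ≥ 1`, any
round-to-nearest rounding whose roundoff is 2-below its result (`RoundoffBelow 2`, e.g. IEEE
round-half-even), an exact two-product on the operands (`Tᵢ = eᵢ ⊗ b`, `Tᵢ + tᵢ = eᵢb`) and the
no-underflow model (`b = M_b·2^kb`, components in `F_p ∩ 2^(emin−kb)·F`): if `e` is a weakly
nonoverlapping expansion of floats then `h = SCALE-EXPANSION(e, b)` is a weakly nonoverlapping
expansion of `2m` floats with `Σ hᵢ = b·Σ eᵢ`.  (False under round-half-away, round-half-to-zero and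
round-half-to-odd: module docstring.) -/
theorem scaleExpansion_isWeakExpansion (hp : 1 ≤ p) (hfl : IsRoundNearest p emin fl)
    (hfl2 : RoundoffBelow 2 fl) {tp : ℚ → ℚ → ℚ × ℚ} {e : List ℚ} {b : ℚ} {Mb kb : ℤ}
    (hbrep : b = (Mb : ℚ) * 2 ^ kb) (hMb : |Mb| < 2 ^ p)
    (he : ∀ x ∈ e, IsFloat p emin x) (heU : ∀ x ∈ e, IsFloat p (emin - kb) x)
    (hexp : IsWeakExpansion e)
    (htp : ∀ x ∈ e, (tp x b).1 = fl (x * b) ∧ (tp x b).1 + (tp x b).2 = x * b) :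
    IsWeakExpansion (scaleExpansion tp fl e b) ∧ (scaleExpansion tp fl e b).sum = e.sum * b ∧
      (∀ z ∈ scaleExpansion tp fl e b, IsFloat p emin z) ∧
      (scaleExpansion tp fl e b).length = 2 * e.length := by
  obtain ⟨-, hS, hFl, hlen⟩ :=
    scaleExpansion_nonoverlapping hp hfl hbrep hMb he heU hexp.isExpansion htp
  refine ⟨?_, hS, hFl, hlen⟩
  cases e with
  | nil => rw [scaleExpansion_nil]; exact isWeakExpansion_nil
  | cons x xs =>
    obtain ⟨-, hxsF⟩ := List.forall_mem_cons.mp he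
    obtain ⟨hxU, hxsU⟩ := List.forall_mem_cons.mp heU
    obtain ⟨hx1, -, hxsW⟩ := isWeakExpansion_cons.mp hexp
    obtain ⟨⟨hT, hTt⟩, htps⟩ := List.forall_mem_cons.mp htp
    rw [scaleExpansion_cons]
    set T := (tp x b).1 with hTdef
    set t := (tp x b).2 with htdef
    have ht : t = x * b - fl (x * b) := by linarith
    have hTF : IsFloat p emin T := by rw [hT]; exact (hfl _).1
    -- Lemma 21, base case: `|Q₂| = |T₁| ≤ 2^s|b|` for every later `e_j ∈ 2^s·ℤ`, `|e₁| < 2^s`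
    have hinv : ∀ y ∈ xs, ∃ R : ℤ, emin ≤ R + kb ∧ OnGrid R y ∧ |T| ≤ (2 : ℚ) ^ R * |b| := by
      intro y hy
      obtain ⟨s, hs, hyG, hcs⟩ := (hx1 y hy).below_one.normalize (hxsU y hy)
      have hxs' : |x| < (2 : ℚ) ^ s := by simpa using hcs
      refine ⟨s, by omega, hyG, ?_⟩
      rw [hT]
      refine abs_fl_le_of_abs_le hfl (isFloat_two_zpow_mul_abs hbrep hMb (by omega)) ?_
      rw [abs_mul]; exact mul_le_mul_of_nonneg_right hxs'.le (abs_nonneg b)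
    have hloop := scaleExpansionLoop_pairwise_levels hp hfl hfl2 hbrep hMb xs T hxsF hxsU hxsW.1
      htps hTF hinv
    refine isWeakExpansion_of_pairwise_levels (kb := kb) hexp
      (List.pairwise_cons.mpr ⟨fun z hz => Or.inl ?_, pairwise_levels_mono x hloop⟩)
    -- "The component h₁, computed by Line 1, does not overlap the remaining products by virtue of
    -- Lemma 20" (weak form), nor `Q₂ = T₁`; hence nothing built from them
    have htT : Below 2 t T := by rw [ht, hT]; exact hfl2 (x * b)
    obtain ⟨g, hg, hcg, hTg, -, htpG⟩ := exists_grid_of_below hp hfl hbrep hMb hxsU htps hTF htT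
      (L := []) (by simp) (by simp)
      fun y hy => below_two_err_mul_of_weakBelow hp hfl hbrep hMb hxU (hxsU y hy) (hx1 y hy) hT hTt
    exact ⟨g, onGrid_of_mem_scaleExpansionLoop hp hfl hg hTg htpG z hz, hcg⟩

/-- **THEOREM 3 for IEEE round-half-even** (`roundTiesEven`, `p ≥ 1`): SCALE-EXPANSION maps weakly
nonoverlapping expansions to weakly nonoverlapping expansions. -/
theorem scaleExpansion_isWeakExpansion_roundTiesEven (hp : 1 ≤ p) {tp : ℚ → ℚ → ℚ × ℚ}
    {e : List ℚ} {b : ℚ} {Mb kb : ℤ} (hbrep : b = (Mb : ℚ) * 2 ^ kb) (hMb : |Mb| < 2 ^ p)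
    (he : ∀ x ∈ e, IsFloat p emin x) (heU : ∀ x ∈ e, IsFloat p (emin - kb) x)
    (hexp : IsWeakExpansion e)
    (htp : ∀ x ∈ e, (tp x b).1 = roundTiesEven p emin (x * b) ∧
      (tp x b).1 + (tp x b).2 = x * b) :
    IsWeakExpansion (scaleExpansion tp (roundTiesEven p emin) e b) ∧
      (scaleExpansion tp (roundTiesEven p emin) e b).sum = e.sum * b ∧
      (∀ z ∈ scaleExpansion tp (roundTiesEven p emin) e b, IsFloat p emin z) ∧
      (scaleExpansion tp (roundTiesEven p emin) e b).length = 2 * e.length :=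
  scaleExpansion_isWeakExpansion hp (isRoundNearest_roundTiesEven hp)
    (roundoffBelow_two_roundTiesEven p emin) hbrep hMb he heU hexp htp

/-- **THEOREM 3 with the FMA two-product** (`twoProdFMA`, any `RoundoffBelow 2` round-to-nearest):
`SCALE-EXPANSION(e, b)` of a weakly nonoverlapping `e` is weakly nonoverlapping, `= b·Σeᵢ`. -/
theorem scaleExpansion_twoProdFMA_isWeakExpansion (hp : 1 ≤ p) (hfl : IsRoundNearest p emin fl)
    (hfl2 : RoundoffBelow 2 fl) {e : List ℚ} {b : ℚ} {Mb kb : ℤ}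
    (hbrep : b = (Mb : ℚ) * 2 ^ kb) (hMb : |Mb| < 2 ^ p)
    (he : ∀ x ∈ e, IsFloat p emin x) (heU : ∀ x ∈ e, IsFloat p (emin - kb) x)
    (hexp : IsWeakExpansion e) :
    IsWeakExpansion (scaleExpansion (twoProdFMA fl) fl e b) ∧
      (scaleExpansion (twoProdFMA fl) fl e b).sum = e.sum * b ∧
      (∀ z ∈ scaleExpansion (twoProdFMA fl) fl e b, IsFloat p emin z) ∧
      (scaleExpansion (twoProdFMA fl) fl e b).length = 2 * e.length :=
  scaleExpansion_isWeakExpansion hp hfl hfl2 hbrep hMb he heU hexp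
    fun x hx => twoProdFMA_exact_of_rep hp hfl hbrep hMb (heU x hx)

end Summit.Ventures.CertifiedArithmetic.Expansions
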